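import Summits.ABC.IUTFork.DAGC312k
import Summits.ABC.IUTFork.DAGL4a
import Summits.ABC.IUTFork.DAGL4b
import Summits.ABC.IUTFork.DAGL4p
import Summits.ABC.IUTFork.DAGL4q
import Summits.ABC.IUTFork.DAGL4r
import Summits.ABC.IUTFork.DAGL4s
import Summits.ABC.IUTFork.DAGL4t
import Summits.ABC.IUTFork.DAGL4u
import Summits.ABC.IUTFork.DAGL4w
import HarnessLib

/-!
# L4 LAYER CERTIFICATE, part A — VERSION v4 — the [AbsTopIII] members of the [IUTchIII] Cor 3.12 cone, packaged BY NAME over the kernel DAG index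

abc-iut cell, director-abc 2026-08-26T05:19:55Z (C2) «each layer files `Conditional/Layer<k>OfS.lean` = the layer's nodes discharged modulo S +
facts (a conjunction theorem), so the apex imports six certificates instead of 793 nodes»; C lead abc-iut-plan (plan/C/ABC-OF-S-SPEC.md §3);
shape = the L6 pattern of record (plan/L6/CERT-L6.md §1, conjunct conventions K1–K5, R-def (b); files `Conditional/Layer6OfS*.lean`).
Generator and v0–v3 of record: seat abc-iut-w6-d032 (wave W6, block C; row CERT-L4, TAKE 06:40:28Z); this v4 run by seat abc-iut-w6-d071
(gen 3; CERT-L2 writer of record) on the L4 lead's GO 2026-08-26T13:53:03Z, tools used read-only. v4 (2026-08-26T14:0xZ): since v3 (overlay @36 rows, COUNT 59) the L4 lead countersigned plan/L4/DISCHARGE-OVERLAY-L4.tsv rows 37–56 (COUNT 60→74): claim-conjunct moves Residual→Discharged = part A N_AbsTopIII_Cor3_6_ii · N_AbsTopIII_Cor4_5_iv · N_AbsTopIII_Cor3_6_iv · N_AbsTopIII_Cor4_5_ii · N_AbsTopIII_Cor4_5_v, part B N_AbsAnab_Prop1_2_1_iii · N_AbsAnab_Prop1_2_1_iv · N_AbsTopI_Thm2_6_iv;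 K4 data aliases now lead-discharged (census text only) = N_AbsTopIII_Cor1_10_i · N_AbsTopIII_Prop3_2_i · N_AbsTopI_Prop2_3_i · N_AbsTopIII_Cor3_6_i · N_AbsTopI_Thm2_6_iii; AbsTopIII:Cor2.9 (count 62, AT READING) STAYS Residual per RULING #8j (upstream (G) binder); AbsTopIII:Rmk1.5.4(i) (count 65) is not a Cor 3.12 cone member (no row). MAP of record:
HOME/staging/w6/w6-d071/g3/cert4/CERT-L4-MAP-v4.tsv (+ CERT-L4-OVERRIDES-v4.tsv)
(mechanical: plan/COR312-CONE.tsv @06:15:02Z L4 rows × plan/DAG.tsv kernel_id/status × the index `Summits/ABC/IUTFork/DAGL4*.lean` of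
abc-iut-c312-2, parts DAGC312k, DAGL4a, DAGL4b, DAGL4p, DAGL4q, DAGL4r, DAGL4s, DAGL4t, DAGL4u, DAGL4w). STATUS SOURCE = plan/DAG.tsv status (= COR312-CONE status_class) OVERLAID by the L4 lead's countersigned
node-level discharges plan/L4/DISCHARGE-OVERLAY-L4.tsv (NODES wins; rows tagged OVERRIDE below); further moves land as the next versioned files (append-only).

THIS FILE PROVES NOTHING NEW AND ASSERTS NOTHING: every conjunct is an index Prop `N_<id>` (or index sub-row Prop `N_<id>_L<nn>` / `_r<n>`)
BY NAME, universe-instantiated with shared level names `u₁ u₂ u₃ u₄` (positional: a conjunct's i-th universe parameter is `uᵢ`), and every witness is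
the index's own `_holds` / `_part` term BY NAME — no tactic proof of content, no restatement, no new `def … : Prop` fact, no `instance`, no schema
∀-closed.  It PACKAGES the [AbsTopIII] slice of the L4 cone into ONE discharged conjunction and ONE residual conjunction for the apex
`Conditional/AbcOfS` (via the top file `Conditional/Layer4OfS.lean`, binder `Layer4Residual4`; this v4 file SUPERSEDES the conjunctions of the v3 part, which stays in the tree as the record — gate rule append-only: never mutate a def body).

COUNT LINE (split form «nodes = d + r + d_data + not-indexed»): **[AbsTopIII] slice 105 = d 44 (DAG-discharged claim nodes; conjuncts of
`Layer4DischargedA4`, + 3 witnessed index sub-rows of those nodes) + r 27 (Residual: DAG-landed claim nodes = this slice's entries on the C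
scoreboard; conjuncts of `Layer4ResidualA4`) + d_data 34 (K4: index data aliases `abbrev N_<id> := @decl` of definitions / structures /
FACT-style named Props — omitted from the conjunctions, NAME-CHECKED below as `example := @N_…`; DAG-discharged 16 · DAG-landed 18) + not-indexed 0
(K5; listed).  44 + 27 + 34 + 0 = 105.**
KERNEL NOTE (honest, as in the L6 certificate): every index claim Prop is a `StatementOf` conjunction of LANDED theorems, so each RESIDUAL
conjunct is ALSO kernel-inhabited by the index's `_part`/`_holds`; «discharged vs residual» is the DAG/NODES row STATUS (the judgement that the
typed theorems cover the printed item), not kernel provability — r is a documented bookkeeping count; no residual conjunct is an open kernel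
obligation.  S consumed at L4: NO (S = `PilotKummerIndRelated` enters at the Cor 3.12 node, c312's layer).  FACT-LIST inputs: the named
facts bound INSIDE the conjoined statements (instance forms, by F-id) are those of the L4 lead's feeder plan/L4/CONE-L4.tsv /
plan/L4/FACT-LIST-L4-witnesses.tsv; v0 does not re-census them (inputs named, not endorsed).
HONEST FRAMING: typed ≠ proved; indexed ≠ endorsed; witnessed ≠ lead-discharged; nothing here asserts that abc is proved or refuted or
takes a side on [IUTchIII] Cor. 3.12. [claim: Mochizuki2012, status: disputed] (node texts). Version: v4 2026-08-26.

d_data — K4 index data aliases (tag [data]); text = node · index alias · index part · DAG status: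
* AbsTopIII:Cor1.10(i) [Corollary] — `N_AbsTopIII_Cor1_10_i` (DAGL4p.lean); DAG landed(p407641) → OVERRIDE discharged (L4-lead overlay DISCHARGED ✓ (count 60, 2026-08-26T12:03Z) [p436245 p438943 p433768])
* AbsTopIII:Cor2.3(ii) [Corollary] — `N_AbsTopIII_Cor2_3_ii` (DAGL4q.lean); DAG landed(p404386) → OVERRIDE discharged (L4-lead overlay discharged(p421228) COUNTERSIGNED 08:03Z (count bullet 04:17)
* AbsTopIII:Cor2.8 [Corollary] — `N_AbsTopIII_Cor2_8` (DAGL4q.lean); DAG landed(p408225)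
* AbsTopIII:Cor3.6(i) [Corollary] — `N_AbsTopIII_Cor3_6_i` (DAGL4r.lean); DAG landed(p405806) → OVERRIDE discharged (L4-lead overlay DISCHARGED ✓ T1 standard over abstract LogFrobeniusData (count 68, 2026-08-26T13:22Z) [p406882 p407521 p409048])
* AbsTopIII:Cor3.6(iii) [Corollary] — `N_AbsTopIII_Cor3_6_iii` (DAGL4r.lean); DAG landed(p405806)
* AbsTopIII:Cor5.10(iii) [Corollary] — `N_AbsTopIII_Cor5_10_iii` (DAGL4u.lean); DAG landed(p415682)
* AbsTopIII:Cor5.2(ii) [Corollary] — `N_AbsTopIII_Cor5_2_ii` (DAGL4s.lean); DAG landed(p406984)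
* AbsTopIII:Cor5.2(iii) [Corollary] — `N_AbsTopIII_Cor5_2_iii` (DAGL4t.lean); DAG landed(p406984)
* AbsTopIII:Cor5.2(iv) [Corollary] — `N_AbsTopIII_Cor5_2_iv` (DAGL4t.lean); DAG landed(p406984)
* AbsTopIII:Cor5.2(vi) [Corollary] — `N_AbsTopIII_Cor5_2_vi` (DAGL4t.lean); DAG landed(p415250)
* AbsTopIII:Cor5.2(vii) [Corollary] — `N_AbsTopIII_Cor5_2_vii` (DAGL4t.lean); DAG landed(p415250)
* AbsTopIII:Cor5.5(ii) [Corollary] — `N_AbsTopIII_Cor5_5_ii` (DAGL4w.lean); DAG landed(p408757) → OVERRIDE discharged (L4-lead overlay discharged(p412791,p418567) COUNTERSIGNED 08:03Z (in count since gen)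
* AbsTopIII:Cor5.5(iii) [Corollary] — `N_AbsTopIII_Cor5_5_iii` (DAGL4t.lean); DAG landed(p408757)
* AbsTopIII:Cor5.5(vi) [Corollary] — `N_AbsTopIII_Cor5_5_vi` (DAGL4t.lean); DAG landed(p415682)
* AbsTopIII:Def2.1(iv) [Definition] — `N_AbsTopIII_Def2_1_iv` (DAGL4p.lean); DAG discharged(p406318)
* AbsTopIII:Def4.1(i) [Definition] — `N_AbsTopIII_Def4_1_i` (DAGL4s.lean); DAG discharged(p417024)
* AbsTopIII:Def4.1(v) [Definition] — `N_AbsTopIII_Def4_1_v` (DAGL4s.lean); DAG discharged(p415198)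
* AbsTopIII:Def5.1(i) [Definition] — `N_AbsTopIII_Def5_1_i` (DAGL4s.lean); DAG discharged(p405186)
* AbsTopIII:Def5.1(ii) [Definition] — `N_AbsTopIII_Def5_1_ii` (DAGL4s.lean); DAG discharged(p405186)
* AbsTopIII:Def5.1(v) [Definition] — `N_AbsTopIII_Def5_1_v` (DAGL4s.lean); DAG discharged(p406984)
* AbsTopIII:Def5.1(vi) [Definition] — `N_AbsTopIII_Def5_1_vi` (DAGL4s.lean); DAG discharged(p406984)
* AbsTopIII:Def5.4(i) [Definition] — `N_AbsTopIII_Def5_4_i` (DAGL4t.lean); DAG landed(p406984)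
* AbsTopIII:Def5.4(iv) [Definition] — `N_AbsTopIII_Def5_4_iv` (DAGL4t.lean); DAG landed(p405623)
* AbsTopIII:Def5.4(vi) [Definition] — `N_AbsTopIII_Def5_4_vi` (DAGL4t.lean); DAG landed(p405623)
* AbsTopIII:Def5.6(ii) [Definition] — `N_AbsTopIII_Def5_6_ii` (DAGL4t.lean); DAG landed
* AbsTopIII:Def5.6(iii) [Definition] — `N_AbsTopIII_Def5_6_iii` (DAGL4t.lean); DAG discharged(p405623)
* AbsTopIII:Def5.6(iv) [Definition] — `N_AbsTopIII_Def5_6_iv` (DAGL4t.lean); DAG discharged(p405623)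
* AbsTopIII:Prop1.1(ii) [Proposition] — `N_AbsTopIII_Prop1_1_ii` (DAGL4b.lean); DAG landed(p403944)
* AbsTopIII:Prop1.6(i) [Proposition] — `N_AbsTopIII_Prop1_6_i` (DAGL4p.lean); DAG landed(p405975)
* AbsTopIII:Prop1.6(iii) [Proposition] — `N_AbsTopIII_Prop1_6_iii` (DAGL4p.lean); DAG landed(p409101)
* AbsTopIII:Prop2.2(i) [Proposition] — `N_AbsTopIII_Prop2_2_i` (DAGL4q.lean); DAG landed(p404386) → OVERRIDE discharged (L4-lead overlay discharged(p420453) COUNTERSIGNED 08:03Z (count bullet 04:10)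
* AbsTopIII:Prop3.2(i) [Proposition] — `N_AbsTopIII_Prop3_2_i` (DAGL4q.lean); DAG landed(p406795) → OVERRIDE discharged (L4-lead overlay DISCHARGED ✓ (count 61, 2026-08-26T12:09Z) [p438734 p440649 p440895])
* AbsTopIII:Prop3.3(i) [Proposition] — `N_AbsTopIII_Prop3_3_i` (DAGL4r.lean); DAG landed(p406795) → OVERRIDE discharged (L4-lead overlay DISCHARGED ✓ AT READING «TCG canonical junction» (count 56, 2026-08-26T10:3xZ) [p432997 p433629 p434641])
* AbsTopIII:Prop5.8(vii) [Proposition] — `N_AbsTopIII_Prop5_8_vii` (DAGL4t.lean); DAG landed(p405623)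

index sub-rows of RESIDUAL / data nodes (witnessed in the index; NAME-CHECKED below, not conjoined — the parent node is not a DAG-discharged claim node):
* `N_AbsTopIII_Cor2_9_0_r5` (parent AbsTopIII:Cor2.9; witness `N_AbsTopIII_Cor2_9_0_r5_holds`)
* `N_AbsTopIII_Cor2_9_a_r2` (parent AbsTopIII:Cor2.9; witness `N_AbsTopIII_Cor2_9_a_r2_holds`)
* `N_AbsTopIII_Cor2_9_a_r3` (parent AbsTopIII:Cor2.9; witness `N_AbsTopIII_Cor2_9_a_r3_holds`)
* `N_AbsTopIII_Cor2_9_a_r4` (parent AbsTopIII:Cor2.9; witness `N_AbsTopIII_Cor2_9_a_r4_holds`)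
* `N_AbsTopIII_Cor2_9_b_r3` (parent AbsTopIII:Cor2.9; witness `N_AbsTopIII_Cor2_9_b_r3_holds`)
* `N_AbsTopIII_Prop5_8_ii_L01` (parent AbsTopIII:Prop5.8(ii); witness `N_AbsTopIII_Prop5_8_ii_L01_holds`)
* `N_AbsTopIII_Prop5_8_ii_L05a` (parent AbsTopIII:Prop5.8(ii); witness `N_AbsTopIII_Prop5_8_ii_L05a_holds`)
* `N_AbsTopIII_Prop5_8_ii_L05b` (parent AbsTopIII:Prop5.8(ii); witness `N_AbsTopIII_Prop5_8_ii_L05b_holds`)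
* `N_AbsTopIII_Prop5_8_ii_L08` (parent AbsTopIII:Prop5.8(ii); witness `N_AbsTopIII_Prop5_8_ii_L08_holds`)
* `N_AbsTopIII_Cor2_8_a_r5` (parent AbsTopIII:Cor2.8; witness `N_AbsTopIII_Cor2_8_a_r5_holds`)
* `N_AbsTopIII_Cor2_8_a_r6` (parent AbsTopIII:Cor2.8; witness `N_AbsTopIII_Cor2_8_a_r6_holds`)
* `N_AbsTopIII_Cor2_8_b_r12` (parent AbsTopIII:Cor2.8; witness `N_AbsTopIII_Cor2_8_b_r12_holds`)
-/

namespace Summit.ABC.IUTFork.Conditional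

open Summit.ABC.IUTFork.DAG

universe u₁ u₂ u₃ u₄

/-- **L4 discharged, part A** ([AbsTopIII]): the DAG-discharged claim nodes of the slice (44 nodes, 47 conjuncts incl. witnessed
index sub-rows), each the index Prop BY NAME. [claim: Mochizuki2012, status: disputed] -/
def Layer4DischargedA4 : Prop :=
  -- AbsTopIII:Cor1.10(ii) [Corollary] · DAG landed(p410210) → OVERRIDE discharged (L4-lead overlay discharged(p430877,p431130) COUNTERSIGNED 08:06Z (count 51→52; typed) · DAGL4p.lean · `_part`
  N_AbsTopIII_Cor1_10_ii.{u₁}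
  -- AbsTopIII:Cor2.3(i) [Corollary] · DAG landed(p404386) → OVERRIDE discharged (L4-lead overlay discharged(p420927) COUNTERSIGNED (T1)) · DAGL4q.lean · `_part`
  ∧ N_AbsTopIII_Cor2_3_i.{u₁, u₂}
  -- AbsTopIII:Cor2.7 [Corollary] · DAG landed(p408225) → OVERRIDE discharged (L4-lead overlay DISCHARGED ✓ AT READING «typed claims (c)+(d)» (count 55) [p433667 p420464]) · DAGL4u.lean · `_part`
  ∧ N_AbsTopIII_Cor2_7.{u₁}
  --   sub-row of AbsTopIII:Cor2.7 · DAGL4w.lean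
  ∧ N_AbsTopIII_Cor2_7_b_r9
  --   sub-row of AbsTopIII:Cor2.7 · DAGL4w.lean
  ∧ N_AbsTopIII_Cor2_7_c_r12
  --   sub-row of AbsTopIII:Cor2.7 · DAGL4w.lean
  ∧ N_AbsTopIII_Cor2_7_c_r16
  -- AbsTopIII:Cor3.6(ii) [Corollary] · DAG landed(p405806) → OVERRIDE discharged (L4-lead overlay DISCHARGED ✓ T1-by-name at the Def-3.1 shape (count 69, 2026-08-26T13:36Z; RULING #6b amended:  [p415699 p405806 p407155]) · DAGL4r.lean · `_part`
  ∧ N_AbsTopIII_Cor3_6_ii.{u₁}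
  -- AbsTopIII:Cor3.6(iv) [Corollary] · DAG landed(p405806) → OVERRIDE discharged (L4-lead overlay DISCHARGED ✓ T2 (MLF model ∀ P modulo Cor-1.10 datum I = Prop3.2(iv) by name + one object; Lemm [p418071 p446491]) · DAGL4r.lean · `_part`
  ∧ N_AbsTopIII_Cor3_6_iv.{u₁, u₂, u₃}
  -- AbsTopIII:Cor4.5(i) [Corollary] · DAG landed(p407855) → OVERRIDE discharged (L4-lead overlay discharged(p409048) COUNTERSIGNED (T1)) · DAGL4s.lean · `_part`
  ∧ N_AbsTopIII_Cor4_5_i.{u₁}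
  -- AbsTopIII:Cor4.5(ii) [Corollary] · DAG landed(p407855) → OVERRIDE discharged (L4-lead overlay DISCHARGED ✓ T1-by-name at the Def-4.1 shape (Cor3.6(ii) standard; supersedes gen-3 F-0307 crit [p428204]) · DAGL4s.lean · `_part`
  ∧ N_AbsTopIII_Cor4_5_ii.{u₁}
  -- AbsTopIII:Cor4.5(iii) [Corollary] · DAG landed(p408426) → OVERRIDE discharged (L4-lead overlay discharged(p412184) COUNTERSIGNED (in count since 04:00Z bul) · DAGL4s.lean · `_part`
  ∧ N_AbsTopIII_Cor4_5_iii.{u₁}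
  -- AbsTopIII:Cor4.5(iv) [Corollary] · DAG landed(p407855) → OVERRIDE discharged (L4-lead overlay DISCHARGED ✓ T2 (Def-4.1 shape ∀ 𝔄 + one object, EXACT iff Nonempty EA; Lemma 4.4 inside; genui [p428449 p418568]) · DAGL4s.lean · `_part`
  ∧ N_AbsTopIII_Cor4_5_iv.{u₁, u₂, u₃}
  -- AbsTopIII:Cor4.5(v) [Corollary] · DAG landed(p407855) → OVERRIDE discharged (L4-lead overlay DISCHARGED ✓ AT READING «Prop 4.2 (i) id-rigidity by name» (all four sentences; compat zero bin [p438765 p433622 p425471]) · DAGL4s.lean · `_part`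
  ∧ N_AbsTopIII_Cor4_5_v.{u₁}
  -- AbsTopIII:Cor5.10(i) [Corollary] · DAG landed(p404735) → OVERRIDE discharged (L4-lead overlay DISCHARGED ✓ AT READING «Prop5.7(i) rule: THE genuine logarithms» (count 58, 2026-08-26T11:05Z) [p404735]) · DAGL4u.lean · `_part`
  ∧ N_AbsTopIII_Cor5_10_i.{u₁}
  -- AbsTopIII:Cor5.10(ii) [Corollary] · DAG landed(p404735) → OVERRIDE discharged (L4-lead overlay DISCHARGED ✓ AT READING «Prop5.7(i) rule: THE genuine logarithms» (count 59, 2026-08-26T11:05Z) [p404735 p406442]) · DAGL4u.lean · `_part`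
  ∧ N_AbsTopIII_Cor5_10_ii
  -- AbsTopIII:Cor5.5(i) [Corollary] · DAG landed(p408757) → OVERRIDE discharged (L4-lead overlay discharged(p410593) COUNTERSIGNED (T1)) · DAGL4t.lean · `_part`
  ∧ N_AbsTopIII_Cor5_5_i.{u₁}
  -- AbsTopIII:Cor5.5(v) [Corollary] · DAG landed(p408757) → OVERRIDE discharged (L4-lead overlay discharged(p425490) COUNTERSIGNED (T1)) · DAGL4t.lean · `_part`
  ∧ N_AbsTopIII_Cor5_5_v.{u₁}
  -- AbsTopIII:Def2.1(i) [Definition] · DAG discharged(p404386) · DAGL4p.lean · `_holds`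
  ∧ N_AbsTopIII_Def2_1_i.{u₁}
  -- AbsTopIII:Def2.1(ii) [Definition] · DAG discharged(p404386) · DAGL4p.lean · `_holds`
  ∧ N_AbsTopIII_Def2_1_ii.{u₁}
  -- AbsTopIII:Def2.1(iii) [Definition] · DAG discharged(p406318) · DAGL4p.lean · `_holds`
  ∧ N_AbsTopIII_Def2_1_iii.{u₁}
  -- AbsTopIII:Def3.1(i) [Definition] · DAG discharged(p404880) · DAGL4q.lean · `_holds`
  ∧ N_AbsTopIII_Def3_1_i.{u₁}
  -- AbsTopIII:Def3.1(ii) [Definition] · DAG discharged(p406258) · DAGL4q.lean · `_holds`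
  ∧ N_AbsTopIII_Def3_1_ii
  -- AbsTopIII:Def3.1(iii) [Definition] · DAG discharged(p406808) · DAGL4q.lean · `_holds`
  ∧ N_AbsTopIII_Def3_1_iii
  -- AbsTopIII:Def3.1(iv) [Definition] · DAG discharged(p404880) · DAGL4q.lean · `_holds`
  ∧ N_AbsTopIII_Def3_1_iv
  -- AbsTopIII:Def3.1(v) [Definition] · DAG discharged(p404880) · DAGL4q.lean · `_holds`
  ∧ N_AbsTopIII_Def3_1_v.{u₁}
  -- AbsTopIII:Def3.1(vi) [Definition] · DAG discharged(p414720) · DAGL4q.lean · `_holds`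
  ∧ N_AbsTopIII_Def3_1_vi.{u₁, u₂, u₃, u₄}
  -- AbsTopIII:Def3.5(i) [Definition] · DAG discharged(p405623) · DAGL4r.lean · `_holds`
  ∧ N_AbsTopIII_Def3_5_i.{u₁, u₂, u₃}
  -- AbsTopIII:Def3.5(ii) [Definition] · DAG discharged(p407855) · DAGL4r.lean · `_holds`
  ∧ N_AbsTopIII_Def3_5_ii.{u₁, u₂, u₃}
  -- AbsTopIII:Def3.5(iii) [Definition] · DAG discharged(p408024) · DAGL4r.lean · `_holds`
  ∧ N_AbsTopIII_Def3_5_iii.{u₁, u₂}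
  -- AbsTopIII:Def3.5(iv) [Definition] · DAG discharged(p408929) · DAGL4r.lean · `_holds`
  ∧ N_AbsTopIII_Def3_5_iv.{u₁, u₂}
  -- AbsTopIII:Def3.5(v) [Definition] · DAG discharged(p410142) · DAGL4r.lean · `_holds`
  ∧ N_AbsTopIII_Def3_5_v.{u₁, u₂, u₃}
  -- AbsTopIII:Def3.5(vi) [Definition] · DAG discharged(p410142) · DAGL4r.lean · `_holds`
  ∧ N_AbsTopIII_Def3_5_vi.{u₁}
  -- AbsTopIII:Def4.1(iii) [Definition] · DAG discharged(p415198) · DAGL4s.lean · `_holds`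
  ∧ N_AbsTopIII_Def4_1_iii.{u₁}
  -- AbsTopIII:Def4.1(iv) [Definition] · DAG discharged(p415198) · DAGL4s.lean · `_holds`
  ∧ N_AbsTopIII_Def4_1_iv.{u₁}
  -- AbsTopIII:Def5.1(iii) [Definition] · DAG discharged(p405186) · DAGL4s.lean · `_holds`
  ∧ N_AbsTopIII_Def5_1_iii.{u₁}
  -- AbsTopIII:Def5.1(iv) [Definition] · DAG discharged(p415250) · DAGL4s.lean · `_holds`
  ∧ N_AbsTopIII_Def5_1_iv.{u₁}
  -- AbsTopIII:Def5.6(i) [Definition] · DAG discharged(p404450) · DAGL4t.lean · `_holds`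
  ∧ N_AbsTopIII_Def5_6_i.{u₁}
  -- AbsTopIII:Prop1.3 [Proposition] · DAG landed(p403944) → OVERRIDE discharged (L4-lead overlay discharged(p403944) COUNTERSIGNED (T1)) · DAGL4b.lean · `_part`
  ∧ N_AbsTopIII_Prop1_3.{u₁, u₂}
  -- AbsTopIII:Prop2.2(ii) [Proposition] · DAG landed(p404386) → OVERRIDE discharged (L4-lead overlay discharged(p420933) COUNTERSIGNED (T1)) · DAGL4q.lean · `_part`
  ∧ N_AbsTopIII_Prop2_2_ii.{u₁, u₂}
  -- AbsTopIII:Prop2.5 [Proposition] · DAG landed(p407343) → OVERRIDE discharged (L4-lead overlay discharged(p414437) COUNTERSIGNED (T1)) · DAGL4q.lean · `_part`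
  ∧ N_AbsTopIII_Prop2_5
  -- AbsTopIII:Prop2.6 [Proposition] · DAG landed(p407343) → OVERRIDE discharged (L4-lead overlay discharged(p412533) COUNTERSIGNED (T2: structure-inhabited d) · DAGL4q.lean · `_part`
  ∧ N_AbsTopIII_Prop2_6
  -- AbsTopIII:Prop3.3(ii) [Proposition] · DAG landed(p406795) → OVERRIDE discharged (L4-lead overlay DISCHARGED ✓ AT READING (Q) (count 54, 2026-08-26T08:39Z) [p432154 p430685 p418751]) · DAGL4r.lean · `_part`
  ∧ N_AbsTopIII_Prop3_3_ii.{u₁}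
  -- AbsTopIII:Prop5.7(i) [Proposition] · DAG landed(p403734) → OVERRIDE discharged (L4-lead overlay discharged(p403734,p404178,p405043,p405719) COUNTERSIGNED 07:52Z (count 50→51; w6-d0) · DAGL4a.lean · `_part`
  ∧ N_AbsTopIII_Prop5_7_i.{u₁}
  -- AbsTopIII:Prop5.7(ii) [Proposition] · DAG landed(p403789) → OVERRIDE discharged (L4-lead overlay DISCHARGED ✓ (count 57, 2026-08-26T11:05Z) [p403789 p405138]) · DAGL4t.lean · `_part`
  ∧ N_AbsTopIII_Prop5_7_ii
  -- AbsTopIII:Prop5.8(iv) [Proposition] · DAG landed(p404450) → OVERRIDE discharged (L4-lead overlay discharged(p411667) COUNTERSIGNED (T2: structure-inhabited d) · DAGL4t.lean · `_part`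
  ∧ N_AbsTopIII_Prop5_8_iv.{u₁}
  -- AbsTopIII:Prop5.8(v) [Proposition] · DAG landed(p404450) → OVERRIDE discharged (L4-lead overlay discharged(p411667) COUNTERSIGNED (T2: structure-inhabited d) · DAGL4t.lean · `_part`
  ∧ N_AbsTopIII_Prop5_8_v
  -- AbsTopIII:Prop5.8(vi) [Proposition] · DAG landed(p403899) → OVERRIDE discharged (L4-lead overlay discharged(p411667) COUNTERSIGNED (T2: structure-inhabited d) · DAGL4t.lean · `_part`
  ∧ N_AbsTopIII_Prop5_8_vi

/-- `Layer4DischargedA4` holds: the index witnesses BY NAME (terms only). [claim: Mochizuki2012, status: disputed] -/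
theorem layer4DischargedA4_holds : Layer4DischargedA4.{u₁, u₂, u₃, u₄} :=
  ⟨N_AbsTopIII_Cor1_10_ii_part, N_AbsTopIII_Cor2_3_i_part, N_AbsTopIII_Cor2_7_part,
    N_AbsTopIII_Cor2_7_b_r9_holds, N_AbsTopIII_Cor2_7_c_r12_holds, N_AbsTopIII_Cor2_7_c_r16_holds,
    N_AbsTopIII_Cor3_6_ii_part, N_AbsTopIII_Cor3_6_iv_part, N_AbsTopIII_Cor4_5_i_part, N_AbsTopIII_Cor4_5_ii_part,
    N_AbsTopIII_Cor4_5_iii_part, N_AbsTopIII_Cor4_5_iv_part, N_AbsTopIII_Cor4_5_v_part,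
    N_AbsTopIII_Cor5_10_i_part, N_AbsTopIII_Cor5_10_ii_part, N_AbsTopIII_Cor5_5_i_part, N_AbsTopIII_Cor5_5_v_part,
    N_AbsTopIII_Def2_1_i_holds, N_AbsTopIII_Def2_1_ii_holds, N_AbsTopIII_Def2_1_iii_holds,
    N_AbsTopIII_Def3_1_i_holds, N_AbsTopIII_Def3_1_ii_holds, N_AbsTopIII_Def3_1_iii_holds,
    N_AbsTopIII_Def3_1_iv_holds, N_AbsTopIII_Def3_1_v_holds, N_AbsTopIII_Def3_1_vi_holds,
    N_AbsTopIII_Def3_5_i_holds, N_AbsTopIII_Def3_5_ii_holds, N_AbsTopIII_Def3_5_iii_holds,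
    N_AbsTopIII_Def3_5_iv_holds, N_AbsTopIII_Def3_5_v_holds, N_AbsTopIII_Def3_5_vi_holds,
    N_AbsTopIII_Def4_1_iii_holds, N_AbsTopIII_Def4_1_iv_holds, N_AbsTopIII_Def5_1_iii_holds,
    N_AbsTopIII_Def5_1_iv_holds, N_AbsTopIII_Def5_6_i_holds, N_AbsTopIII_Prop1_3_part,
    N_AbsTopIII_Prop2_2_ii_part, N_AbsTopIII_Prop2_5_part, N_AbsTopIII_Prop2_6_part, N_AbsTopIII_Prop3_3_ii_part,
    N_AbsTopIII_Prop5_7_i_part, N_AbsTopIII_Prop5_7_ii_part, N_AbsTopIII_Prop5_8_iv_part,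
    N_AbsTopIII_Prop5_8_v_part, N_AbsTopIII_Prop5_8_vi_part⟩

/-- **L4 residual, part A** ([AbsTopIII]): the DAG-landed (not discharged) claim nodes of the slice (27 conjuncts) — this
slice's entries on the C scoreboard; each the index Prop BY NAME (no theorem asserted here). [claim: Mochizuki2012, status: disputed] -/
def Layer4ResidualA4 : Prop :=
  -- AbsTopIII:Cor1.10(iii) [Corollary] · DAG landed(p405963) · DAGL4p.lean · index witness `_part` (K: kernel-inhabited; residual = not DAG-discharged)
  N_AbsTopIII_Cor1_10_iii.{u₁}
  -- AbsTopIII:Cor2.4 [Corollary] · DAG landed(p407343) · DAGL4q.lean · index witness `_part` (K: kernel-inhabited; residual = not DAG-discharged)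
  ∧ N_AbsTopIII_Cor2_4.{u₁}
  -- AbsTopIII:Cor2.9 [Corollary] · DAG landed(p408225) · DAGL4q.lean · index witness `_part` (K: kernel-inhabited; residual = not DAG-discharged)
  ∧ N_AbsTopIII_Cor2_9
  -- AbsTopIII:Cor3.6(v) [Corollary] · DAG landed(p405806) · DAGL4r.lean · index witness `_part` (K: kernel-inhabited; residual = not DAG-discharged)
  ∧ N_AbsTopIII_Cor3_6_v.{u₁}
  -- AbsTopIII:Cor5.10(iv) [Corollary] · DAG landed(p404735) · DAGL4u.lean · index witness `_part` (K: kernel-inhabited; residual = not DAG-discharged)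
  ∧ N_AbsTopIII_Cor5_10_iv.{u₁}
  -- AbsTopIII:Cor5.2(i) [Corollary] · DAG landed(p405186) · DAGL4s.lean · index witness `_part` (K: kernel-inhabited; residual = not DAG-discharged)
  ∧ N_AbsTopIII_Cor5_2_i.{u₁}
  -- AbsTopIII:Cor5.2(v) [Corollary] · DAG landed(p406993) · DAGL4t.lean · index witness `_part` (K: kernel-inhabited; residual = not DAG-discharged)
  ∧ N_AbsTopIII_Cor5_2_v.{u₁}
  -- AbsTopIII:Cor5.5(iv) [Corollary] · DAG landed(p408757) · DAGL4t.lean · index witness `_part` (K: kernel-inhabited; residual = not DAG-discharged)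
  ∧ N_AbsTopIII_Cor5_5_iv.{u₁}
  -- AbsTopIII:Def4.1(ii) [Definition] · DAG landed · DAGL4s.lean · index witness `_part` (K: kernel-inhabited; residual = not DAG-discharged)
  ∧ N_AbsTopIII_Def4_1_ii.{u₁}
  -- AbsTopIII:Def5.4(ii) [Definition] · DAG landed(p405623) · DAGL4t.lean · index witness `_part` (K: kernel-inhabited; residual = not DAG-discharged)
  ∧ N_AbsTopIII_Def5_4_ii.{u₁}
  -- AbsTopIII:Def5.4(iii) [Definition] · DAG landed(p403899) · DAGL4b.lean · index witness `_part` (K: kernel-inhabited; residual = not DAG-discharged)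
  ∧ N_AbsTopIII_Def5_4_iii
  -- AbsTopIII:Def5.4(v) [Definition] · DAG landed(p403899) · DAGL4b.lean · index witness `_part` (K: kernel-inhabited; residual = not DAG-discharged)
  ∧ N_AbsTopIII_Def5_4_v
  -- AbsTopIII:Def5.4(vii) [Definition] · DAG landed(p404505) · DAGL4b.lean · index witness `_part` (K: kernel-inhabited; residual = not DAG-discharged)
  ∧ N_AbsTopIII_Def5_4_vii.{u₁, u₂}
  -- AbsTopIII:Prop1.1(i) [Proposition] · DAG landed(p403944) · DAGL4b.lean · index witness `_part` (K: kernel-inhabited; residual = not DAG-discharged)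
  ∧ N_AbsTopIII_Prop1_1_i.{u₁, u₂}
  -- AbsTopIII:Prop1.4(i) [Proposition] · DAG landed(p405053) · DAGL4b.lean · index witness `_part` (K: kernel-inhabited; residual = not DAG-discharged)
  ∧ N_AbsTopIII_Prop1_4_i.{u₁}
  -- AbsTopIII:Prop1.4(ii) [Proposition] · DAG landed(p405756) · DAGL4p.lean · index witness `_part` (K: kernel-inhabited; residual = not DAG-discharged)
  ∧ N_AbsTopIII_Prop1_4_ii.{u₁}
  -- AbsTopIII:Prop1.6(ii) [Proposition] · DAG landed(p408762) · DAGL4p.lean · index witness `_part` (K: kernel-inhabited; residual = not DAG-discharged)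
  ∧ N_AbsTopIII_Prop1_6_ii.{u₁}
  -- AbsTopIII:Prop3.2(ii) [Proposition] · DAG landed(p409840) · DAGL4q.lean · index witness `_part` (K: kernel-inhabited; residual = not DAG-discharged)
  ∧ N_AbsTopIII_Prop3_2_ii
  -- AbsTopIII:Prop3.2(iii) [Proposition] · DAG landed(p409840) · DAGL4r.lean · index witness `_part` (K: kernel-inhabited; residual = not DAG-discharged)
  ∧ N_AbsTopIII_Prop3_2_iii
  -- AbsTopIII:Prop3.2(iv) [Proposition] · DAG landed(p406795) · DAGC312k.lean · index witness `_part` (K: kernel-inhabited; residual = not DAG-discharged)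
  ∧ N_AbsTopIII_Prop3_2_iv
  -- AbsTopIII:Prop3.2(v) [Proposition] · DAG landed(p409840) · DAGL4r.lean · index witness `_part` (K: kernel-inhabited; residual = not DAG-discharged)
  ∧ N_AbsTopIII_Prop3_2_v
  -- AbsTopIII:Prop4.2(i) [Proposition] · DAG landed(p413906) · DAGL4s.lean · index witness `_part` (K: kernel-inhabited; residual = not DAG-discharged)
  ∧ N_AbsTopIII_Prop4_2_i.{u₁}
  -- AbsTopIII:Prop4.2(ii) [Proposition] · DAG landed(p413906) · DAGL4s.lean · index witness `_part` (K: kernel-inhabited; residual = not DAG-discharged)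
  ∧ N_AbsTopIII_Prop4_2_ii.{u₁}
  -- AbsTopIII:Prop5.8(i) [Proposition] · DAG landed(p403899) · DAGL4t.lean · index witness `_part` (K: kernel-inhabited; residual = not DAG-discharged)
  ∧ N_AbsTopIII_Prop5_8_i.{u₁}
  -- AbsTopIII:Prop5.8(ii) [Proposition] · DAG landed(p404450) · DAGL4t.lean · index witness `_part` (K: kernel-inhabited; residual = not DAG-discharged)
  ∧ N_AbsTopIII_Prop5_8_ii.{u₁}
  -- AbsTopIII:Prop5.8(iii) [Proposition] · DAG landed(p403899) · DAGL4t.lean · index witness `_part` (K: kernel-inhabited; residual = not DAG-discharged)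
  ∧ N_AbsTopIII_Prop5_8_iii
  -- AbsTopIII:Thm1.9 [Theorem] · DAG landed(p405963) · DAGL4u.lean · index witness `_part` (K: kernel-inhabited; residual = not DAG-discharged)
  ∧ N_AbsTopIII_Thm1_9.{u₁}

/-- The [AbsTopIII] slice of the L4 cone: discharged ∧ residual. [claim: Mochizuki2012, status: disputed] -/
def Layer4ConeA4 : Prop :=
  Layer4DischargedA4.{u₁, u₂, u₃, u₄} ∧ Layer4ResidualA4.{u₁, u₂}

/-- The slice follows from its residual alone (the discharged half is witnessed BY NAME). [claim: Mochizuki2012, status: disputed] -/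
theorem layer4ConeA4_of (h : Layer4ResidualA4.{u₁, u₂}) :
    Layer4ConeA4.{u₁, u₂, u₃, u₄} :=
  ⟨layer4DischargedA4_holds.{u₁, u₂, u₃, u₄}, h⟩

/-! ### d_data rows and residual-node sub-rows — NAME-CHECKED ONLY (the build breaks if an index name drifts; no Prop is asserted) -/
noncomputable example := @N_AbsTopIII_Cor1_10_i.{u₁} -- AbsTopIII:Cor1.10(i) [Corollary] · DAG discharged
noncomputable example := @N_AbsTopIII_Cor2_3_ii -- AbsTopIII:Cor2.3(ii) [Corollary] · DAG discharged
noncomputable example := @N_AbsTopIII_Cor2_8 -- AbsTopIII:Cor2.8 [Corollary] · DAG landed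
noncomputable example := @N_AbsTopIII_Cor3_6_i.{u₁} -- AbsTopIII:Cor3.6(i) [Corollary] · DAG discharged
noncomputable example := @N_AbsTopIII_Cor3_6_iii.{u₁} -- AbsTopIII:Cor3.6(iii) [Corollary] · DAG landed
noncomputable example := @N_AbsTopIII_Cor5_10_iii.{u₁} -- AbsTopIII:Cor5.10(iii) [Corollary] · DAG landed
noncomputable example := @N_AbsTopIII_Cor5_2_ii.{u₁} -- AbsTopIII:Cor5.2(ii) [Corollary] · DAG landed
noncomputable example := @N_AbsTopIII_Cor5_2_iii.{u₁} -- AbsTopIII:Cor5.2(iii) [Corollary] · DAG landed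
noncomputable example := @N_AbsTopIII_Cor5_2_iv.{u₁} -- AbsTopIII:Cor5.2(iv) [Corollary] · DAG landed
noncomputable example := @N_AbsTopIII_Cor5_2_vi.{u₁} -- AbsTopIII:Cor5.2(vi) [Corollary] · DAG landed
noncomputable example := @N_AbsTopIII_Cor5_2_vii.{u₁} -- AbsTopIII:Cor5.2(vii) [Corollary] · DAG landed
noncomputable example := @N_AbsTopIII_Cor5_5_ii.{u₁} -- AbsTopIII:Cor5.5(ii) [Corollary] · DAG discharged
noncomputable example := @N_AbsTopIII_Cor5_5_iii.{u₁} -- AbsTopIII:Cor5.5(iii) [Corollary] · DAG landed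
noncomputable example := @N_AbsTopIII_Cor5_5_vi.{u₁} -- AbsTopIII:Cor5.5(vi) [Corollary] · DAG landed
noncomputable example := @N_AbsTopIII_Def2_1_iv.{u₁} -- AbsTopIII:Def2.1(iv) [Definition] · DAG discharged
noncomputable example := @N_AbsTopIII_Def4_1_i.{u₁} -- AbsTopIII:Def4.1(i) [Definition] · DAG discharged
noncomputable example := @N_AbsTopIII_Def4_1_v.{u₁} -- AbsTopIII:Def4.1(v) [Definition] · DAG discharged
noncomputable example := @N_AbsTopIII_Def5_1_i.{u₁} -- AbsTopIII:Def5.1(i) [Definition] · DAG discharged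
noncomputable example := @N_AbsTopIII_Def5_1_ii.{u₁} -- AbsTopIII:Def5.1(ii) [Definition] · DAG discharged
noncomputable example := @N_AbsTopIII_Def5_1_v -- AbsTopIII:Def5.1(v) [Definition] · DAG discharged
noncomputable example := @N_AbsTopIII_Def5_1_vi.{u₁} -- AbsTopIII:Def5.1(vi) [Definition] · DAG discharged
noncomputable example := @N_AbsTopIII_Def5_4_i.{u₁} -- AbsTopIII:Def5.4(i) [Definition] · DAG landed
noncomputable example := @N_AbsTopIII_Def5_4_iv -- AbsTopIII:Def5.4(iv) [Definition] · DAG landed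
noncomputable example := @N_AbsTopIII_Def5_4_vi -- AbsTopIII:Def5.4(vi) [Definition] · DAG landed
noncomputable example := @N_AbsTopIII_Def5_6_ii.{u₁} -- AbsTopIII:Def5.6(ii) [Definition] · DAG landed
noncomputable example := @N_AbsTopIII_Def5_6_iii.{u₁} -- AbsTopIII:Def5.6(iii) [Definition] · DAG discharged
noncomputable example := @N_AbsTopIII_Def5_6_iv.{u₁} -- AbsTopIII:Def5.6(iv) [Definition] · DAG discharged
noncomputable example := @N_AbsTopIII_Prop1_1_ii.{u₁, u₂} -- AbsTopIII:Prop1.1(ii) [Proposition] · DAG landed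
noncomputable example := @N_AbsTopIII_Prop1_6_i.{u₁} -- AbsTopIII:Prop1.6(i) [Proposition] · DAG landed
noncomputable example := @N_AbsTopIII_Prop1_6_iii.{u₁} -- AbsTopIII:Prop1.6(iii) [Proposition] · DAG landed
noncomputable example := @N_AbsTopIII_Prop2_2_i -- AbsTopIII:Prop2.2(i) [Proposition] · DAG discharged
noncomputable example := @N_AbsTopIII_Prop3_2_i.{u₁} -- AbsTopIII:Prop3.2(i) [Proposition] · DAG discharged
noncomputable example := @N_AbsTopIII_Prop3_3_i.{u₁} -- AbsTopIII:Prop3.3(i) [Proposition] · DAG discharged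
noncomputable example := @N_AbsTopIII_Prop5_8_vii.{u₁} -- AbsTopIII:Prop5.8(vii) [Proposition] · DAG landed
example : N_AbsTopIII_Cor2_9_0_r5 := N_AbsTopIII_Cor2_9_0_r5_holds -- sub-row of AbsTopIII:Cor2.9 (residual)
example : N_AbsTopIII_Cor2_9_a_r2 := N_AbsTopIII_Cor2_9_a_r2_holds -- sub-row of AbsTopIII:Cor2.9 (residual)
example : N_AbsTopIII_Cor2_9_a_r3.{u₁, u₂, u₃, u₄} := N_AbsTopIII_Cor2_9_a_r3_holds -- sub-row of AbsTopIII:Cor2.9 (residual)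
example : N_AbsTopIII_Cor2_9_a_r4 := N_AbsTopIII_Cor2_9_a_r4_holds -- sub-row of AbsTopIII:Cor2.9 (residual)
example : N_AbsTopIII_Cor2_9_b_r3.{u₁, u₂, u₃, u₄} := N_AbsTopIII_Cor2_9_b_r3_holds -- sub-row of AbsTopIII:Cor2.9 (residual)
example : N_AbsTopIII_Prop5_8_ii_L01.{u₁} := N_AbsTopIII_Prop5_8_ii_L01_holds -- sub-row of AbsTopIII:Prop5.8(ii) (residual)
example : N_AbsTopIII_Prop5_8_ii_L05a.{u₁} := N_AbsTopIII_Prop5_8_ii_L05a_holds -- sub-row of AbsTopIII:Prop5.8(ii) (residual)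
example : N_AbsTopIII_Prop5_8_ii_L05b.{u₁} := N_AbsTopIII_Prop5_8_ii_L05b_holds -- sub-row of AbsTopIII:Prop5.8(ii) (residual)
example : N_AbsTopIII_Prop5_8_ii_L08.{u₁, u₂} := N_AbsTopIII_Prop5_8_ii_L08_holds -- sub-row of AbsTopIII:Prop5.8(ii) (residual)
example : N_AbsTopIII_Cor2_8_a_r5 := N_AbsTopIII_Cor2_8_a_r5_holds -- sub-row of AbsTopIII:Cor2.8 (residual)
example : N_AbsTopIII_Cor2_8_a_r6 := N_AbsTopIII_Cor2_8_a_r6_holds -- sub-row of AbsTopIII:Cor2.8 (residual)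
example : N_AbsTopIII_Cor2_8_b_r12 := N_AbsTopIII_Cor2_8_b_r12_holds -- sub-row of AbsTopIII:Cor2.8 (residual)

end Summit.ABC.IUTFork.Conditional
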